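import Mathlib
import HarnessLib
import HarnessLib.Audit
import Summits.SmoothPoincare4.Statement
import Literature.Topology.FourManifolds.CappellShanesonGompfConjectureSmallTraces

/-!
Route: CsArithmeticWalk

CLOSED (retired) 2026-08-15T13:51:32Z by operator:999:1257524 — reason: not-a-thesis: assembly does not conclude the sub-problem Statement — note: D-0027 §2.1 audit (human 2026-08-15: routes that do not decide the summit are removed): the assembly concludes `Literature.Topology.FourManifolds.CappellShanesonSpheresStandard`, not the sub-problem statement; a NEW conforming route may be opened from the same idea (generated `closes : … → _root_.Sm. The file is kept as the record of this route; refuted decls are indexed as negative knowledge (`ledger negatives`).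

# Route CsArithmeticWalk — Gompf's move graph on (trace, ideal class of ℤ[Θₙ]) — prove descent for
every trace ≥ 70, or exhibit the isolated class the counting model predicts

SUB-TARGET ROUTE (positive side, family census): the wall is
`Literature.Topology.FourManifolds.CappellShanesonSpheresStandard` (item stmt-SmoothPoincare4-0391
of route GluckLasagna), NOT `SmoothPoincare4`; CS-standardness implies neither SPC4 nor ¬SPC4 and
this route does not pretend otherwise. It suffices to show X = GOMPF'S CONJECTURE 2 FOR EVERY TRACE:
every A ∈ SL(3,ℤ) with det(A−1) = 1 is Gompf equivalent (conjugations + Gompf's Δ-row moves on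
standard forms) to the Akbulut–Kirby matrix A₀ — the card cs-arithmetic-walk-sieve's WALK-ALL in the
exact Kim–Yamada form the novelty audit asked for (vertices = (trace n, class of ⟨Θₙ−c,d⟩ in ℤ[Θₙ]),
edges X_{c,d,n} ~ X_{c,d,n+kd}). Granted Gompf's three topological theorems (tree leaves
`gompf2010_deltaMove`, `gompf2010_akbulutKirby_framings`, `akbulutKirby1979_sphere_four`, being
discharged by the Literature programme) X gives the wall, det(A−1) = −1 being absorbed by A ↦ A⁻¹
(`IsSurgeredMappingTorusOf.symm`). The tree already PROVES X for traces −7…12 and 14, −9, and Thm A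
(n ↔ 5−n); Kim–Yamada/Iwaki verify it by MAGMA for −64…69 and 71,72,74,78. Planner's calibration
(numbers in § Numbers): a class-group COUNTING MODEL predicts X holds for essentially every class of
|trace| ≲ 10³ and FAILS for most classes beyond, with isolated failures possible from trace ≈ 70 on
— where Iwaki 2025 indeed leaves two classes undecided. The route is therefore opened as a
DICHOTOMY: crux 2 (descent) is the positive line, crux 3 its negation with named candidate
witnesses, crux 4 the provable obstruction that kills one-step descent.
Lean: `∀ n : ℤ, Literature.Topology.FourManifolds.GompfConjectureForTrace n`

## Assembly
CsawDescent → CsawTheoremBWindow → (three topological leaves, as named-fact hypotheses) → wall: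
CsawInduction turns the first two into X = ∀ n, GompfConjectureForTrace n (strong induction on n ≥ 3
with Thm A `gompfConjectureForTrace_iff_five_sub` for traces ≤ 2 and the tree's PROVED window
[−64,69] ⇐ [12,69]); CsawSpheresGlue turns X and the leaves into `CappellShanesonSpheresStandard`.
Both glue items are provable now (the first is proved in Sketch.lean), so the Assembly is M-size
Lean with no new mathematics; cruxes 3 and 4 are not hypotheses of the Assembly (3 is the kill
switch, 4 shapes the attack on 2).

Rationale: WHY THIS LINE. Mechanism (card cs-arithmetic-walk-sieve, KimYamada2023 §2.3–2.4 and Lemma 6.1,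
arXiv:1707.03860 p.20 read): by Latimer–MacDuffee–Taussky (LatimerMacduffee1933, Taussky1949; PROVED
in tree: `isConj_standardCSMatrix_iff_csIdeal`) conjugacy classes of trace-n Cappell–Shaneson
matrices are ideal classes of ℤ[Θₙ], fₙ(x) = x³ − n x² + (n−1)x − 1, and Gompf's Thm 2.1/§3 move
(GompfAGT2010) is the arithmetic jump (c,d,n) ↦ (c,d,n+kd) along a primitive ideal ⟨Θₙ−c,d⟩ of norm
|d| in the class; X = "this graph is connected". What is imported from number theory is not the
card's sieve (its one-step and density-one cruxes are false by counting, § Numbers) but CLASS-GROUP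
COUNTING: h(ℤ[Θₙ]) = n^{2+o(1)} (disc fₙ = (n²−5n+3)² − 32, units Θ, Θ−1 give regulator ≍ log² n,
Brauer–Siegel Brauer1947/Stark1974; fits the published tables: 657 non-trivial classes for 3 ≤ n ≤
69, h(70) = 44) against ≤ n^{1+o(1)} one-step exits — which turns the walk into a quantitative
branching problem and makes BOTH sides of Gompf's conjecture attackable: descent by longer ascending
chains (crux 2), disconnection by an invariant of Gompf moves (crux 3), and the theorem that
Kim–Yamada's Lemma 6.1 criterion dies beyond some trace (crux 4). No prior route or negative (index
empty) touches the CS family; the tree's 14.6 kloc of PROVED CS arithmetic (GompfEquiv,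
standardCSMatrix, Thm A, Lemma 6.1, traces −7…12, 14 and −9, the 11 certified exceptional chains)
makes every item typeable today.

RANKED CRUXES. #0 CsawGompfAllTraces (target) — Gompf's Conjecture 2 for every trace: every A ∈
SL(3,ℤ) with det(A−1) = 1 is Gompf equivalent to A₀ (Kim–Yamada Conj. 2; `GompfConjectureForTrace n`
for all n). (why it might fail: the counting model (§ Numbers) predicts that for n ≳ 10³ most of the
≈ n²/(10.6 log n log(n/2)) classes at trace n lie outside the A₀-component; Iwaki 2025 already
leaves (104,141,70), (37,155,70) undecided.) [KimYamada2023, GompfAGT2010, Iwaki2025,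
arXiv:2404.05096]
#2 CsawDescent (crux) — DESCENT FOR LARGE TRACES (card WALK-ALL, induction form of KY Lemma 6.1 with
chains of any length): for every n ≥ 70 and every A ∈ SL(3,ℤ) with det(A−1) = 1 and tr A = n there
is a Gompf equivalent B with tr B ∈ [6−n, n−1]. With the window [12,69] (support CsawTheoremBWindow)
and Thm A this gives X (support CsawInduction, proved in Sketch.lean). [difficulty: open-problem]
(why it might fail: generic class at trace n has least primitive-ideal norm ≈ h/c₁ ≈ n²/log²n ≫ 2n,
so every first move RAISES |trace| to ≳ n² where h is n⁴: model gives P(connect) ≈ (10³/n)² → 0;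
Iwaki's two trace-70 classes may already be stuck.) [KimYamada2023, Iwaki2025, GompfAGT2010,
CohenLenstra1984]
#3 CsawNotGompfStandard (crux) — NEGATIVE SIDE (¬X, the model's prediction): some Cappell–Shaneson
matrix with det(A−1) = 1 is NOT Gompf equivalent to A₀, i.e. Gompf equivalence has more than one
class. Candidate witnesses: X_{104,141,70}, X_{37,155,70} (Iwaki 2025 Table §4.3, no chain found),
then the undecided classes at traces 73, 75–77. A proof needs an INVARIANT of Gompf moves finer than
det(A−1): it must be compatible with the canonical identifications ℤ[Θₙ]/(d) = ℤ[Θ_{n+kd}]/(d)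
(f_{n+kd} ≡ fₙ mod d) carried by every move — nothing survives at finite level (Pic of finite rings
is trivial), so look at signs/real places (narrow-class or spinor-type ℤ/2 data; Gompf's Lemma 3.3
parity constraints) or at the ℤ[t]-algebra ℤ[t][x]/(x³ − t x² + (t−1)x − 1). [difficulty: XL] (why
it might fail: no invariant of Gompf moves beyond det(A−1) is known (Gompf 2010 §3, KY §1.2: chains
found for all 1314 classes with |trace| ≤ 69); the identifications mod d for ALL d may force any
invariant to be trivial.) [GompfAGT2010, KimYamada2023, Iwaki2025, AitchisonRubinstein1984]
#4 CsawOneStepObstruction (crux) — THE ONE-STEP CRITERION DIES (negation of the card's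
ONE-STEP-DIVISOR item; shapes crux 2): there is N such that for every n ≥ N some Cappell–Shaneson
matrix of trace n is conjugate to NO standard X_{c,d,n} with |d| ≤ 2n − 6, i.e. its class has no
representative satisfying the hypothesis of KY Lemma 6.1, so every chain from it must first raise
|trace|. Paper proof sketch: #classes = h(ℤ[Θₙ]) ≥ n^{2−ε} (Brauer–Siegel for Q(Θₙ), no quadratic
subfield so Stark1974 is even effective; order class-number formula; regulator ≤ 4.5 log² n from the
units Θ, Θ−1; disc → ∞ by Siegel on (n²−5n+3)² − 32 = i²D₀) versus #{primitive ideals of norm ≤ 2n}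
= Σ_{d ≤ 2n} ρₙ(d) ≤ n^{3/2+ε}; LMT surjectivity (Taussky) turns classes into matrices. [difficulty:
L] (why it might fail: "for ALL large n" needs h(ℤ[Θₙ]) ≫ n^{3/2+ε} uniformly: Brauer–Siegel's ε is
per field and ρₙ(p^k) at primes with p² | disc fₙ can reach p^{k/2}; a thin subsequence of n with
tiny field discriminant or huge ρ could escape (then weaken to density one).) [Brauer1947,
Stark1974, KimYamada2023, LatimerMacduffee1933, Taussky1949, arXiv:2509.22386, Cohen1993]
#9 CsawIwakiCandidates (support) — CHEAPEST-FALSIFIER TARGET, positive polarity: Iwaki 2025's two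
undecided trace-70 representatives X_{104,141,70} and X_{37,155,70} (141 | f₇₀(104) = 374919, 155 |
f₇₀(37) = −42625, checked by `decide`) are Gompf equivalent to A₀. Provable by exhibiting chains
(alternating trace moves `gompfEquiv_standardCSMatrix_add_mul` and certified similarities as in
CappellShanesonGompfChains.lean) found by a deeper search (intermediate |trace| up to 10⁵–10⁶,
PARI/Magma class groups); a documented FAILURE of such a search is evidence for crux 3 (attach as
census). [difficulty: M] [Iwaki2025, arXiv:2404.05096, KimYamada2023]
#9 CsawTheoremBWindow (support) — Kim–Yamada's Theorem B on the window [12, 69] in matrix form (the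
hypothesis `hB` of the tree's `forall_gompfConjectureForTrace_of_Icc_twelve`): certified computation
of the class monoids of ℤ[Θₙ] (tables of KimYamada2023 §6.1) + the chains; traces 12 and 14 are
PROVED in tree (CappellShanesonClassGroupTwelve/Fourteen), the 11 exceptional chains certified
(CappellShanesonGompfChains); this item is where the remaining traces land. [difficulty: L]
[KimYamada2023, arXiv:1707.03860]
#9 CsawInduction (support) — ARITHMETIC GLUE, PROVED in Sketch.lean (`csawInduction_of`, from
`forall_gompfConjectureForTrace_of_Icc_twelve`, `aitchisonRubinstein1984_traceNegFiveClasses_holds`,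
`gompfConjectureForTrace_of_five_sub`, `GompfEquiv.det_sub_one_eq`, strong induction on n ≥ 3):
descent for n ≥ 70 + the window [12,69] ⇒ Gompf's conjecture for every trace. [difficulty:
provable-now] [KimYamada2023]
#9 CsawSpheresGlue (support) — TOPOLOGICAL GLUE (provable now from tree theorems): X + Gompf's three
leaves ⇒ the wall. det(A−1) = 1: `nonempty_diffeomorph_sphere_four_of_gompfConjectureForTrace`;
det(A−1) = −1: pass to A⁻¹ (`det_coe_inv_sub_one_fin_three`, `IsSurgeredMappingTorusOf.symm`,
`torusDiffeomorph_symm_apply`, `IsSurgeredMappingTorusOf.congr`). [difficulty: provable-now]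
[GompfAGT2010, KimYamada2023, Akbulut2010, AkbulutKirby1979]

TWO-LAYER PLAN. If CsawIwakiCandidates closes PROVED with short chains for all undecided classes of
traces 70–77, split CsawDescent ⇐ DescentSmallRep → RepGrowth → CsawDescent: (i) classes whose least
primitive-ideal norm is ≤ n^θ descend (θ to be read off the data), (ii) every class at trace n has
such a representative after ≤ L moves. If instead a documented deep search fails on X_{104,141,70},
split CsawNotGompfStandard ⇐ MoveInvariant → InvariantSeparates → CsawNotGompfStandard (an explicit
function on (n, class) constant along ~_S and ~_G; its values differ on X_{104,141,70} and A₀).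

KILL CRITERIA. CsawNotGompfStandard PROVED (any non-standard Gompf class) ⇒ X refuted ⇒ close
`refuted:CsawGompfAllTraces` with census "Gompf's log-transform moves provably do not reach all CS
matrices" and file the invariant as a Literature barrier (CappellShanesonGompfMoveBarrier); the wall
itself stays open (other diffeomorphisms). CsawDescent refuted at a specific n ≥ 70 ⇒ same.
CsawOneStepObstruction REFUTED (one-step descent for infinitely many full traces) ⇒ the counting
model is wrong; re-rank crux 2 up and pivot to the card's density statements.
`CappellShanesonSpheresStandard` or SPC4 proved elsewhere ⇒ route moot for the summit (X remains a
number-theory question; close `superseded`).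

NOT DECOMPOSED YET. The analytic shape of a descent proof (which representatives, how many moves,
bounds on intermediate traces) — layer-2 children of CsawDescent only after the trace-70 computation
says which regime we are in; the class-number lower bound and the root-count bound inside
CsawOneStepObstruction (Brauer–Siegel/Stark, Σρ(d)) — provers attach them with `--supports
CsawOneStepObstruction`; the formal LMT surjectivity (every ideal class is a matrix class; Taussky
Thm 2) — in tree up to `exists_isConj_standardCSMatrix_of_cover`, the general statement is a support
lemma, not an item; any sphere-level statement beyond CsawSpheresGlue (the leaves are Literature
debt, not route items).

CHEAPEST FALSIFIER. Decide Iwaki's undecided representatives, starting with (104,141,70) and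
(37,155,70): a kit/PARI job computing class groups of ℤ[Θₘ] for the traces m ≡ 70 (mod 141), (mod
155) with |m| ≤ 10⁵ (and second-generation moduli), searching for a chain to |trace| ≤ 69 — Iwaki's
Algorithm/§5.1 with a 10³× larger trace bound. Outcomes: chains found ⇒ CsawIwakiCandidates proved,
model recalibrated (record chain length and max |trace| vs n for n = 70…120); no chain within
|trace| ≤ 10⁶ and 6 moves ⇒ strong evidence for crux 3, and the search log is the census. Planner
could not run it this session (plancard mode, hub compute-free; lit remote APIs rate-limited) — it
is the first thing a refuter should queue. Second cheapest: tabulate h(ℤ[Θₙ]) and min-norm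
statistics for 70 ≤ n ≤ 400 (PARI bnfinit, minutes) to test h ≈ n²/(10.6 log n log(n/2)) and the
one-step failure fraction ≈ 1 − 2c₁n/h.

NUMBERS. Class numbers (published tables, KimYamada2023 §6.1 + Remark 1.2; Iwaki2025 §4.3): h = 1
for n ∈ [−4,9] ∪ {11,−6} (tree PROVED), 2 at −5 and 10, 3 at 21, Σ_{3≤n≤69}(h−1) = 657, h(70) = 44,
h(71) = 21, h(72) = 23, h(73) = 38, h(74) = 24, h(75) = 24, h(76) = 35, h(77) = 35, h(78) = 24; fit
h(n) ≈ n²/(10.6 log n log(n/2)) (= 30 at 69, 34 at 75). disc fₙ = n⁴ − 10n³ + 31n² − 30n − 23 = (n²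
− 5n + 3)² − 32 (4729 at n = 11 and −6). One-step window (KY Lemma 6.1) ⇔ representative with |d| ≤
2n − 6; first exceptional representatives at n = 52 (KY, 11 chains up to 11 moves, intermediate
|trace| ≤ 230); at n = 70 six representatives exceed 134 and two have no published chain. Counting
model (planner, NOTES.md): one-move neighbourhood of the principal vertices ≈ Σ_d ρ(d)·min(1, H/d)
with H = Σ_m 1/h(m) ≈ 45 classes per trace; giant component = classes whose least primitive-ideal
norm is ≲ 4M*, where the fixed point h(M*) = 4c₁M*(1 + log 2) gives M* ≈ 1.1–2.5 × 10³ for c₁ ∈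
[0.6, 1] (c₁ = density of primitive ideals); predicted fraction of Gompf-standard classes at trace n
≈ min(1, 4c₁M*(1 + log(n/2M*))/h(n)), i.e. ≈ 1 below M* and decaying like (M*/n)² log n above; first
isolated classes expected from the coupon tail h·e^{−E/h} already at n ≈ 70–300. Card items
ONE-STEP-DIVISOR and WALK-DENSITY: false for all large n by h ≥ n^{2−ε} > n^{3/2+ε} ≥ Σ_{d≤2n} ρ(d).
Items at open: 9 (1 target, 3 cruxes, 4 support, 1 assembly).

DEFINITION REQUESTS. None. Everything is stated over tree declarations: `GompfEquiv`,
`GompfConjectureForTrace`, `standardCSMatrix`, `csPoly`, `akbulutKirbyMatrix`, the three leaves and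
`CappellShanesonSpheresStandard`. A later MoveInvariant child of crux 3 may posit a new object
(interface + construction statement, per D-0014) — not now.

Novelty: Searches (2026-08-15): `lit read arxiv:1707.03860` (KY, p.5, p.20–21 READ: Lemma 6.1, the 11 chains,
"Understanding when two standard matrices are similar … seems to be a difficult question"); `lit
read arxiv:2404.05096` (Iwaki2025 §4.3 tables 70–78, §5.1 Thm 5.1 and chains READ); `lit search
--hybrid "Gompf equivalence Cappell-Shaneson matrix trace ideal class"` (10 book hits, LMT
background only: Berrick–Keating 2000, Fröhlich–Taylor 1990); `lit vsearch "Cappell-Shaneson … Gompf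
equivalence ideal classes cubic order"` (Gordon–Kirby 1984 = AitchisonRubinstein1984 pp 35,46; Kirby
1989 p.88); `lit search --hybrid "Brauer-Siegel … lower bound"` (Cohen1993 p.268, Noordwijkerhout
1983 = CohenLenstra1984); `lit galaxy search "Cappell-Shaneson spheres Gompf conjecture trace"
--star all` (0 rows; pdf/crabby stars timed out); `lit search --source zbmath "Cappell-Shaneson
homotopy spheres" --year-from 2015` (6: KimYamada2023, Iwaki2025, Endo–Iwaki–Pajitnov
arXiv:2507.10885 (CS polynomials of degree 4–6, READ abstract: not about trace-n arithmetic),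
Cho–Hong–Lee arXiv:2509.22386 (READ §1, §5: UPPER bound for #Cl̄(ℤ[Θₘ]) via orbital integrals, Δ_φ =
m⁴−10m³+31m²−30m−23, 2,3 ∤ Δ_φ, totally real iff m ≥ 6 or m ≤ −1; cites Choi–Kim 2025 on Ennola's
conjecture for the units of this family), Torres arXiv:2607.15062, Bais–Torres 2025); `lit search
--source crossref "Cappell-Shaneson Gompf equivalence"` (10: Gompf 1991/2010, Akbulut 2010, older CS
papers); openalex/s2/arxiv APIs HTTP 429 this  [refs: 1707.03860, 2404.05096, 2507.10885, 2509.22386, 2607.15062, arxiv:1707.03860, arxiv:2404.05096, Iwaki2025, AitchisonRubinstein1984, Cohen1993, CohenLenstra1984, KimYamada2023, GompfAGT2010]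

Barriers (technique_class: cappell-shaneson-arithmetic-walk, class-group-counting): - technique_class: cappell-shaneson-arithmetic-walk, class-group-counting
- Literature.Barriers.SmoothPoincare4.CappellShanesonFamilyBarrier: not an obstacle but the base
case — the decided family A_m = X_{1,1,m+2} is exactly the set of principal vertices, the seed of
the giant component, and Gompf's small-entry classes (`gompf2010_theorem32_d`,
`gompf2010_corollary35`, `CappellShanesonSmallEntryBarrier` in the same file: |d| < 17 ⇒ standard)
are one-step-descending vertices; the route never re-litigates them, extends the decided set class
by class, and crux 4 says precisely that the small-entry mechanism cannot cover all classes beyond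
some trace — so the line goes around it by multi-step chains (crux 2) or concedes disconnection
(crux 3).
- Literature.Barriers.SmoothPoincare4.GaugeSumBarrierFour: not engaged — no invariant of 4-manifolds
(gauge-theoretic, sum-stable or homeomorphism-invariant, cf. TopologicalInvariantsBlind.lean) is
computed; the invariant sought in crux 3 is of Gompf MOVES ON MATRICES, and a non-trivial Gompf
class is NOT claimed exotic (its spheres may be standard by other diffeomorphisms), so b₂ = 0
blindness is irrelevant to this arithmetic statement about SL(3,ℤ).
- Literature.Barriers.SmoothPoincare4.HCobordismInvariantBarrierFour: not engaged (no h-cobordism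
argument).
- Negatives index: empty for SmoothPoincare4 at filing (ledger negatives, 2026-08-15); the card's
own items ONE-STEP-DIVISOR / WALK-DENSITY are recorded here as false-by-counting and a

History (route lifecycle, newest last):
- 2026-08-15T13:51:32Z · CLOSED retired — not-a-thesis: assembly does not conclude the sub-problem Statement (operator:999:1257524)

sub-problem: SmoothPoincare4 · status: closed(retired) · opened planner-plancard-SmoothPoincare4-SmoothPoinca-bf6ac9a3-0 2026-08-15T11:30:35Z · rev 0 · ledger route-SmoothPoincare4-CsArithmeticWalk
GENERATED by the gate from the ledger (D-0016/17). Provers cite these decls: `theorem foo : Summit.SmoothPoincare4.SmoothPoincare4.Theses.CsArithmeticWalk.<Decl> := …` in Summits/SmoothPoincare4/SmoothPoincare4/Theorems/<Name>.lean.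
-/

namespace Summit.SmoothPoincare4.SmoothPoincare4.Theses.CsArithmeticWalk

open scoped BigOperators Topology Manifold Classical MeasureTheory ProbabilityTheory Matrix InnerProductSpace ComplexConjugate ContinuousMap
open Filter Set Function TopologicalSpace MeasureTheory

attribute [summit_statement] _root_.SmoothPoincare4

open Literature.SPC4

/-- item stmt-SmoothPoincare4-4244 · target · rank 0 · closed · moot by None · by planner
why it might fail: the counting model (§ Numbers) predicts that for n ≳ 10³ most of the ≈ n²/(10.6 log n log(n/2)) classes at trace n lie outside the A₀-component; Iwaki 2025 already leaves (104,141,70), (37,155,70) undecided.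
sources: KimYamada2023, GompfAGT2010, Iwaki2025, arXiv:2404.05096
[target] Gompf's Conjecture 2 for every trace: every A ∈ SL(3,ℤ) with det(A−1) = 1 is Gompf
equivalent to A₀ (Kim–Yamada Conj. 2; `GompfConjectureForTrace n` for all n). -/
@[route_item "route-SmoothPoincare4-CsArithmeticWalk"]
def CsawGompfAllTraces : Prop :=
  ∀ n : ℤ, Literature.Topology.FourManifolds.GompfConjectureForTrace n

/-- item stmt-SmoothPoincare4-4245 · crux · rank 2 · closed · moot by None · by planner
why it might fail: generic class at trace n has least primitive-ideal norm ≈ h/c₁ ≈ n²/log²n ≫ 2n, so every first move RAISES |trace| to ≳ n² where h is n⁴: model gives P(connect) ≈ (10³/n)² → 0; Iwaki's two trace-70 classes may already be stuck.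
sources: KimYamada2023, Iwaki2025, GompfAGT2010, CohenLenstra1984
[crux] DESCENT FOR LARGE TRACES (card WALK-ALL, induction form of KY Lemma 6.1 with chains of any
length): for every n ≥ 70 and every A ∈ SL(3,ℤ) with det(A−1) = 1 and tr A = n there is a Gompf
equivalent B with tr B ∈ [6−n, n−1]. With the window [12,69] (support CsawTheoremBWindow) and Thm A
this gives X (support CsawInduction, proved in Sketch.lean). [difficulty: open-problem] -/
@[route_item "route-SmoothPoincare4-CsArithmeticWalk"]
def CsawDescent : Prop :=
  ∀ n : ℤ, 70 ≤ n → ∀ A : Matrix.SpecialLinearGroup (Fin 3) ℤ, ((A : Matrix (Fin 3) (Fin 3) ℤ) - 1).det = 1 → Matrix.trace (A : Matrix (Fin 3) (Fin 3) ℤ) = n → ∃ B : Matrix.SpecialLinearGroup (Fin 3) ℤ, Literature.Topology.FourManifolds.GompfEquiv A B ∧ Matrix.trace (B : Matrix (Fin 3) (Fin 3) ℤ) ∈ Set.Icc (6 - n) (n - 1)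

/-- item stmt-SmoothPoincare4-4246 · crux · rank 3 · closed · moot by None · by planner
why it might fail: no invariant of Gompf moves beyond det(A−1) is known (Gompf 2010 §3, KY §1.2: chains found for all 1314 classes with |trace| ≤ 69); the identifications mod d for ALL d may force any invariant to be trivial.
sources: GompfAGT2010, KimYamada2023, Iwaki2025, AitchisonRubinstein1984
[crux] NEGATIVE SIDE (¬X, the model's prediction): some Cappell–Shaneson matrix with det(A−1) = 1 is
NOT Gompf equivalent to A₀, i.e. Gompf equivalence has more than one class. Candidate witnesses:
X_{104,141,70}, X_{37,155,70} (Iwaki 2025 Table §4.3, no chain found), then the undecided classes at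
traces 73, 75–77. A proof needs an INVARIANT of Gompf moves finer than det(A−1): it must be
compatible with the canonical identifications ℤ[Θₙ]/(d) = ℤ[Θ_{n+kd}]/(d) (f_{n+kd} ≡ fₙ mod d)
carried by every move — nothing survives at finite level (Pic of finite rings is trivial), so look
at signs/real places (narrow-class or spinor-type ℤ/2 data; Gompf's Lemma 3.3 parity constraints) or
at the ℤ[t]-algebra ℤ[t][x]/(x³ − t x² + (t−1)x − 1). [difficulty: XL] -/
@[route_item "route-SmoothPoincare4-CsArithmeticWalk"]
def CsawNotGompfStandard : Prop :=
  ∃ A : Matrix.SpecialLinearGroup (Fin 3) ℤ, ((A : Matrix (Fin 3) (Fin 3) ℤ) - 1).det = 1 ∧ ¬ Literature.Topology.FourManifolds.GompfEquiv A Literature.Topology.FourManifolds.akbulutKirbyMatrix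

/-- item stmt-SmoothPoincare4-4247 · crux · rank 4 · closed · moot by None · by planner
why it might fail: "for ALL large n" needs h(ℤ[Θₙ]) ≫ n^{3/2+ε} uniformly: Brauer–Siegel's ε is per field and ρₙ(p^k) at primes with p² | disc fₙ can reach p^{k/2}; a thin subsequence of n with tiny field discriminant or huge ρ could escape (then weaken to density one).
sources: Brauer1947, Stark1974, KimYamada2023, LatimerMacduffee1933, Taussky1949, arXiv:2509.22386
[crux] THE ONE-STEP CRITERION DIES (negation of the card's ONE-STEP-DIVISOR item; shapes crux 2):
there is N such that for every n ≥ N some Cappell–Shaneson matrix of trace n is conjugate to NO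
standard X_{c,d,n} with |d| ≤ 2n − 6, i.e. its class has no representative satisfying the hypothesis
of KY Lemma 6.1, so every chain from it must first raise |trace|. Paper proof sketch: #classes =
h(ℤ[Θₙ]) ≥ n^{2−ε} (Brauer–Siegel for Q(Θₙ), no quadratic subfield so Stark1974 is even effective;
order class-number formula; regulator ≤ 4.5 log² n from the units Θ, Θ−1; disc → ∞ by Siegel on
(n²−5n+3)² − 32 = i²D₀) versus #{primitive ideals of norm ≤ 2n} = Σ_{d ≤ 2n} ρₙ(d) ≤ n^{3/2+ε}; LMT
surjectivity (Taussky) turns classes into matrices. [difficulty: L] -/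
@[route_item "route-SmoothPoincare4-CsArithmeticWalk"]
def CsawOneStepObstruction : Prop :=
  ∃ N : ℤ, ∀ n : ℤ, N ≤ n → ∃ A : Matrix.SpecialLinearGroup (Fin 3) ℤ, ((A : Matrix (Fin 3) (Fin 3) ℤ) - 1).det = 1 ∧ Matrix.trace (A : Matrix (Fin 3) (Fin 3) ℤ) = n ∧ ∀ (c d : ℤ) (h : d ∣ (Literature.Topology.FourManifolds.csPoly n).eval c), IsConj A (Literature.Topology.FourManifolds.standardCSMatrix c d n h) → 2 * n - 6 < |d|

/-- item stmt-SmoothPoincare4-4248 · support · rank 9 · closed · moot by None · by planner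
sources: Iwaki2025, arXiv:2404.05096, KimYamada2023
[support] CHEAPEST-FALSIFIER TARGET, positive polarity: Iwaki 2025's two undecided trace-70
representatives X_{104,141,70} and X_{37,155,70} (141 | f₇₀(104) = 374919, 155 | f₇₀(37) = −42625,
checked by `decide`) are Gompf equivalent to A₀. Provable by exhibiting chains (alternating trace
moves `gompfEquiv_standardCSMatrix_add_mul` and certified similarities as in
CappellShanesonGompfChains.lean) found by a deeper search (intermediate |trace| up to 10⁵–10⁶,
PARI/Magma class groups); a documented FAILURE of such a search is evidence for crux 3 (attach as
census). [difficulty: M] -/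
@[route_item "route-SmoothPoincare4-CsArithmeticWalk"]
def CsawIwakiCandidates : Prop :=
  (∀ h : (141 : ℤ) ∣ (Literature.Topology.FourManifolds.csPoly 70).eval 104, Literature.Topology.FourManifolds.GompfEquiv (Literature.Topology.FourManifolds.standardCSMatrix 104 141 70 h) Literature.Topology.FourManifolds.akbulutKirbyMatrix) ∧ (∀ h : (155 : ℤ) ∣ (Literature.Topology.FourManifolds.csPoly 70).eval 37, Literature.Topology.FourManifolds.GompfEquiv (Literature.Topology.FourManifolds.standardCSMatrix 37 155 70 h) Literature.Topology.FourManifolds.akbulutKirbyMatrix)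

/-- item stmt-SmoothPoincare4-4249 · support · rank 9 · closed · moot by None · by planner
sources: KimYamada2023, arXiv:1707.03860
[support] Kim–Yamada's Theorem B on the window [12, 69] in matrix form (the hypothesis `hB` of the
tree's `forall_gompfConjectureForTrace_of_Icc_twelve`): certified computation of the class monoids
of ℤ[Θₙ] (tables of KimYamada2023 §6.1) + the chains; traces 12 and 14 are PROVED in tree
(CappellShanesonClassGroupTwelve/Fourteen), the 11 exceptional chains certified
(CappellShanesonGompfChains); this item is where the remaining traces land. [difficulty: L] -/
@[route_item "route-SmoothPoincare4-CsArithmeticWalk"]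
def CsawTheoremBWindow : Prop :=
  ∀ n ∈ Set.Icc (12 : ℤ) 69, Literature.Topology.FourManifolds.GompfConjectureForTrace n

/-- item stmt-SmoothPoincare4-4250 · support · rank 9 · closed · moot by None · by planner
sources: KimYamada2023
[support] ARITHMETIC GLUE, PROVED in Sketch.lean (`csawInduction_of`, from
`forall_gompfConjectureForTrace_of_Icc_twelve`, `aitchisonRubinstein1984_traceNegFiveClasses_holds`,
`gompfConjectureForTrace_of_five_sub`, `GompfEquiv.det_sub_one_eq`, strong induction on n ≥ 3):
descent for n ≥ 70 + the window [12,69] ⇒ Gompf's conjecture for every trace. [difficulty: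
provable-now] -/
@[route_item "route-SmoothPoincare4-CsArithmeticWalk"]
def CsawInduction : Prop :=
  (∀ n : ℤ, 70 ≤ n → ∀ A : Matrix.SpecialLinearGroup (Fin 3) ℤ, ((A : Matrix (Fin 3) (Fin 3) ℤ) - 1).det = 1 → Matrix.trace (A : Matrix (Fin 3) (Fin 3) ℤ) = n → ∃ B : Matrix.SpecialLinearGroup (Fin 3) ℤ, Literature.Topology.FourManifolds.GompfEquiv A B ∧ Matrix.trace (B : Matrix (Fin 3) (Fin 3) ℤ) ∈ Set.Icc (6 - n) (n - 1)) → (∀ n ∈ Set.Icc (12 : ℤ) 69, Literature.Topology.FourManifolds.GompfConjectureForTrace n) → ∀ n : ℤ, Literature.Topology.FourManifolds.GompfConjectureForTrace n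

/-- item stmt-SmoothPoincare4-4251 · support · rank 9 · closed · moot by None · by planner
sources: GompfAGT2010, KimYamada2023, Akbulut2010, AkbulutKirby1979
[support] TOPOLOGICAL GLUE (provable now from tree theorems): X + Gompf's three leaves ⇒ the wall.
det(A−1) = 1: `nonempty_diffeomorph_sphere_four_of_gompfConjectureForTrace`; det(A−1) = −1: pass to
A⁻¹ (`det_coe_inv_sub_one_fin_three`, `IsSurgeredMappingTorusOf.symm`,
`torusDiffeomorph_symm_apply`, `IsSurgeredMappingTorusOf.congr`). [difficulty: provable-now] -/
@[route_item "route-SmoothPoincare4-CsArithmeticWalk"]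
def CsawSpheresGlue : Prop :=
  (∀ n : ℤ, Literature.Topology.FourManifolds.GompfConjectureForTrace n) → Literature.Topology.FourManifolds.gompf2010_deltaMove.{0} → Literature.Topology.FourManifolds.gompf2010_akbulutKirby_framings.{0, 0} → Literature.Topology.FourManifolds.akbulutKirby1979_sphere_four → Literature.Topology.FourManifolds.CappellShanesonSpheresStandard

/-- item stmt-SmoothPoincare4-4252 · assembly · rank 1 · closed · moot by None · by planner
sources: KimYamada2023, GompfAGT2010
[assembly] CsawDescent → CsawTheoremBWindow → gompf2010_deltaMove → gompf2010_akbulutKirby_framings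
→ akbulutKirby1979_sphere_four → CappellShanesonSpheresStandard. -/
@[route_item "route-SmoothPoincare4-CsArithmeticWalk"]
def Assembly : Prop :=
  (∀ n : ℤ, 70 ≤ n → ∀ A : Matrix.SpecialLinearGroup (Fin 3) ℤ, ((A : Matrix (Fin 3) (Fin 3) ℤ) - 1).det = 1 → Matrix.trace (A : Matrix (Fin 3) (Fin 3) ℤ) = n → ∃ B : Matrix.SpecialLinearGroup (Fin 3) ℤ, Literature.Topology.FourManifolds.GompfEquiv A B ∧ Matrix.trace (B : Matrix (Fin 3) (Fin 3) ℤ) ∈ Set.Icc (6 - n) (n - 1)) → (∀ n ∈ Set.Icc (12 : ℤ) 69, Literature.Topology.FourManifolds.GompfConjectureForTrace n) → Literature.Topology.FourManifolds.gompf2010_deltaMove.{0} → Literature.Topology.FourManifolds.gompf2010_akbulutKirby_framings.{0, 0} → Literature.Topology.FourManifolds.akbulutKirby1979_sphere_four → Literature.Topology.FourManifolds.CappellShanesonSpheresStandard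

end Summit.SmoothPoincare4.SmoothPoincare4.Theses.CsArithmeticWalk
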